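import Literature.Topology.PlanarFoliations.LeafStructure
import HarnessLib

/-!
# Compact leaves are circles: the two-ends structure and connectedness minus a point

Topic: Topology / PlanarFoliations, sequel to `LeafStructure.lean`. A compact leaf of a
bi-oriented foliation with one-dimensional leaves is covered by two agreeing arc charts
(`exists_two_agreeing_arcCharts`). Milnor's lemma (tree: `OneManifoldTwoCharts.lean`) then
gives the **two-ends structure** of the cover — the overlap consists of exactly the two ends of
each arc, glued increasingly — since one component only would glue the two arcs into a single
arc chart of the whole compact leaf, i.e. a homeomorphism with `ℝ`:

* `exists_twoEnds` (**proved**): arc charts `e`, `f` covering the leaf with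
  `e.symm '' (a₁, ∞) = f.symm '' (-∞, b₁)`, `e.symm '' (-∞, a₂) = f.symm '' (b₂, ∞)`,
  `a₂ ≤ a₁`, and `e.source ∩ f.source` equal to the union of these two ends;
* `isConnected_compl_singleton` (**proved**): **the leaf minus any point is connected** (the
  point lies in one arc; the two rays of that arc accumulate, by compactness, outside the arc,
  i.e. in the complementary middle piece of the other arc, which is connected).

Transferred to the ambient space (`isConnected_leaf_diff_singleton`): for a compact leaf
`C = F.leaf x` and `z ∈ C`, the set `C \ {z}` is connected. All statements are [folklore]
(Milnor 1965, Appendix; the use is Poincaré–Bendixson theory for closed leaves).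
-/

noncomputable section

open Set Filter Function
open _root_.Topology
open Literature.Topology.FourManifolds Literature.Topology.FourManifolds.Foliation
  Literature.Topology.FourManifolds.OneManifold

namespace Literature.Topology.PlanarFoliations

/-! ## Generic: a compact space covered by two compatible arc charts -/

section Generic

variable {M : Type*} [TopologicalSpace M] [T2Space M] [LocallyConnectedSpace M] [ConnectedSpace M] [CompactSpace M]
  {e f : OpenPartialHomeomorph M ℝ} {p : M}

omit [T2Space M] [LocallyConnectedSpace M] [ConnectedSpace M] in
/-- A compact space has no global arc chart. [folklore] -/
theorem source_ne_univ (he : e.target = univ) : e.source ≠ univ := by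
  intro h
  have hc : IsCompact e.source := by rw [h]; exact isCompact_univ
  have : IsCompact (e '' e.source) := hc.image_of_continuousOn e.continuousOn
  rw [e.image_source_eq_target, he] at this
  exact noncompact_univ ℝ this

/-- The two-ends data of a pair of arc charts `e`, `f`: the overlap is the union of the right end
`e.symm '' (a₁, ∞) = f.symm '' (-∞, b₁)` and the left end `e.symm '' (-∞, a₂) = f.symm '' (b₂, ∞)`
of `e`, with `a₂ ≤ a₁` and increasing transitions. [folklore] -/
def TwoEnds (e f : OpenPartialHomeomorph M ℝ) (a₁ a₂ b₁ b₂ : ℝ) : Prop :=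
  a₂ ≤ a₁ ∧ e.symm '' Ioi a₁ = f.symm '' Iio b₁ ∧ e.symm '' Iio a₂ = f.symm '' Ioi b₂ ∧
    e.source ∩ f.source = e.symm '' Ioi a₁ ∪ e.symm '' Iio a₂ ∧
    StrictMonoOn (f ∘ e.symm) (Ioi a₁) ∧ StrictMonoOn (f ∘ e.symm) (Iio a₂)

omit [ConnectedSpace M] in
/-- **Two-ends structure, core case.** Two covering arc charts of a compact space, neither source
inside the other, whose overlap has a component equal to the right end of `e` and the left end
of `f` with increasing transition: the overlap is exactly the two ends of `e`, glued
increasingly to the two ends of `f` (one component only would glue the arcs to a global arc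
chart). [cite: MilnorTDV1965, Appendix (Classifying 1-manifolds), Lemma p. 56] -/
theorem twoEnds_of_core (he : e.target = univ) (hf : f.target = univ) (hcov : e.source ∪ f.source = univ)
    (hef : ¬e.source ⊆ f.source) (hfe : ¬f.source ⊆ e.source)
    {a₁ b₁ : ℝ} (hA : e '' connectedComponentIn (e.source ∩ f.source) p = Ioi a₁)
    (hB : f '' connectedComponentIn (e.source ∩ f.source) p = Iio b₁)
    (hmono : StrictMonoOn (f ∘ e.symm) (e '' connectedComponentIn (e.source ∩ f.source) p)) :
    ∃ a₂ b₂ : ℝ, TwoEnds e f a₁ a₂ b₁ b₂ := by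
  set K₁ := connectedComponentIn (e.source ∩ f.source) p with hK₁
  have hK₁sub : K₁ ⊆ e.source ∩ f.source := connectedComponentIn_subset _ _
  have hK₁e : K₁ ⊆ e.source := hK₁sub.trans inter_subset_left
  have hK₁f : K₁ ⊆ f.source := hK₁sub.trans inter_subset_right
  have hK₁eq : K₁ = e.symm '' Ioi a₁ := eq_symm_image_of_image_eq hK₁e hA
  have hK₁eq' : K₁ = f.symm '' Iio b₁ := eq_symm_image_of_image_eq hK₁f hB
  have hmono₁ : StrictMonoOn (f ∘ e.symm) (Ioi a₁) := hA ▸ hmono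
  have himg₁ : (f ∘ e.symm) '' Ioi a₁ = Iio b₁ := image_comp_symm_eq hK₁e hA hB
  by_cases hone : e.source ∩ f.source ⊆ K₁
  · exfalso
    obtain ⟨e', he', hsrc⟩ := exists_arcChart_union he hf ((hone.antisymm hK₁sub).trans hK₁eq) hmono₁ himg₁
    exact source_ne_univ he' (hsrc.trans hcov)
  -- two components
  obtain ⟨p', hp', hp'K⟩ := not_subset.1 hone
  have hd : Disjoint K₁ (connectedComponentIn (e.source ∩ f.source) p') := disjoint_connectedComponentIn hp'K
  obtain ⟨a₂, b₂, hA₂, hB₂, hmono₂⟩ := second_component he hf hef hfe hp' hA hB hd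
  set K₂ := connectedComponentIn (e.source ∩ f.source) p' with hK₂
  have hK₂e : K₂ ⊆ e.source := (connectedComponentIn_subset _ _).trans inter_subset_left
  have hK₂f : K₂ ⊆ f.source := (connectedComponentIn_subset _ _).trans inter_subset_right
  have hK₂eq : K₂ = e.symm '' Iio a₂ := eq_symm_image_of_image_eq hK₂e hA₂
  have hK₂eq' : K₂ = f.symm '' Ioi b₂ := eq_symm_image_of_image_eq hK₂f hB₂
  have hmono₂' : StrictMonoOn (f ∘ e.symm) (Iio a₂) := hA₂ ▸ hmono₂
  have ha : a₂ ≤ a₁ := le_of_disjoint_ends (by rwa [← hK₁eq, ← hK₂eq])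
  -- no third component
  have hcomp : e.source ∩ f.source = K₁ ∪ K₂ := by
    apply Subset.antisymm
    · intro q hq
      by_contra hnot
      rw [mem_union, not_or] at hnot
      obtain ⟨a₃, b₃, hA₃, -, -⟩ := second_component he hf hef hfe hq hA hB (disjoint_connectedComponentIn hnot.1)
      have hK₃e : connectedComponentIn (e.source ∩ f.source) q ⊆ e.source :=
        (connectedComponentIn_subset _ _).trans inter_subset_left
      have hdis := image_disjoint_of_disjoint hK₂e hK₃e (disjoint_connectedComponentIn hnot.2)
      rw [hA₂, hA₃] at hdis
      have h₁ : min a₂ a₃ - 1 < a₂ := by linarith [min_le_left a₂ a₃]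
      have h₂ : min a₂ a₃ - 1 < a₃ := by linarith [min_le_right a₂ a₃]
      exact Set.disjoint_left.1 hdis h₁ h₂
    · exact union_subset hK₁sub (connectedComponentIn_subset _ _)
  refine ⟨a₂, b₂, ha, hK₁eq.symm.trans hK₁eq', hK₂eq.symm.trans hK₂eq', ?_, hmono₁, hmono₂'⟩
  rw [hcomp, hK₁eq, hK₂eq]

/-- **Two-ends structure of a compact space covered by two compatible arc charts** (Milnor's
lemma: the overlap has two components since one would glue the arcs into a global arc chart of
the compact space; a decreasing transition is excluded by compatibility). Up to replacing both
charts by their reflections. [cite: MilnorTDV1965, Appendix (Classifying 1-manifolds), Lemma p. 56] -/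
theorem exists_twoEnds_of_pair (he : e.target = univ) (hf : f.target = univ) (hcov : e.source ∪ f.source = univ)
    (hcompat : ∀ q ∈ e.source ∩ f.source, ∀ᶠ r in 𝓝 q, (e r < e q ↔ f r < f q) ∧ (e q < e r ↔ f q < f r)) :
    ∃ (e' f' : OpenPartialHomeomorph M ℝ) (a₁ a₂ b₁ b₂ : ℝ), e'.target = univ ∧ f'.target = univ ∧
      e'.source = e.source ∧ f'.source = f.source ∧ TwoEnds e' f' a₁ a₂ b₁ b₂ := by
  have hfe : ¬f.source ⊆ e.source := fun h ↦ source_ne_univ he (by rw [← hcov, union_eq_self_of_subset_right h])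
  have hef : ¬e.source ⊆ f.source := fun h ↦ source_ne_univ hf (by rw [← hcov, union_eq_self_of_subset_left h])
  -- the overlap is nonempty (connectedness)
  have hne : (e.source ∩ f.source).Nonempty := by
    by_contra hempty
    rw [not_nonempty_iff_eq_empty] at hempty
    have hclopen : IsClopen e.source := by
      refine ⟨⟨?_⟩, e.open_source⟩
      have : e.sourceᶜ = f.source := by
        apply Subset.antisymm
        · intro q hq
          have : q ∈ e.source ∪ f.source := by rw [hcov]; exact mem_univ _
          exact this.resolve_left hq
        · intro q hq hqe
          have : q ∈ e.source ∩ f.source := ⟨hqe, hq⟩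
          rw [hempty] at this
          exact this
      rw [this]
      exact f.open_source
    rcases isClopen_iff.1 hclopen with h | h
    · exact (arc_source_nonempty he).ne_empty h
    · exact hfe (h ▸ subset_univ _)
  obtain ⟨p, hp⟩ := hne
  -- the transition is increasing on the component of `p`
  have hm : StrictMonoOn (f ∘ e.symm) (e '' connectedComponentIn (e.source ∩ f.source) p) := by
    rcases transition_strictMonoOn_or_strictAntiOn he f p with hm | ha
    · exact hm
    · exfalso
      have hKo : IsOpen (e '' connectedComponentIn (e.source ∩ f.source) p) :=
        e.isOpen_image_of_subset_source ((e.open_source.inter f.open_source).connectedComponentIn)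
          ((connectedComponentIn_subset _ _).trans inter_subset_left)
      have hdis : LocDisagree e f p := by
        have h := eventually_lt_iff_of_strictMonoOn (c := f.transHomeomorph (Homeomorph.neg ℝ)) hKo
          (by rw [he]; exact subset_univ _) (strictMonoOn_neg_of_strictAntiOn ha)
          ⟨e p, mem_image_of_mem e (mem_connectedComponentIn hp), e.left_inv hp.1⟩
        exact h.mono fun q hq ↦ by
          simp only [neg_chart_apply, neg_lt_neg_iff] at hq
          exact hq
      exact not_locAgree_of_locDisagree hf hp.2 (hcompat p hp) hdis
  rcases overlap_cases he hf hp hm with h | h | ⟨a₁, b₁, hA, hB⟩ | ⟨a, b, hA, hB⟩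
  · exact absurd h hef
  · exact absurd h hfe
  · obtain ⟨a₂, b₂, h2⟩ := twoEnds_of_core he hf hcov hef hfe hA hB hm
    exact ⟨e, f, a₁, a₂, b₁, b₂, he, hf, rfl, rfl, h2⟩
  · -- mirror image: reflect both charts
    have hAR : e.transHomeomorph (Homeomorph.neg ℝ) ''
        connectedComponentIn ((e.transHomeomorph (Homeomorph.neg ℝ)).source ∩
          (f.transHomeomorph (Homeomorph.neg ℝ)).source) p = Ioi (-a) := by
      rw [neg_chart_source, neg_chart_source, neg_chart_image, hA]
      ext t
      rw [Set.mem_neg, mem_Iio, mem_Ioi, neg_lt]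
    have hBR : f.transHomeomorph (Homeomorph.neg ℝ) ''
        connectedComponentIn ((e.transHomeomorph (Homeomorph.neg ℝ)).source ∩
          (f.transHomeomorph (Homeomorph.neg ℝ)).source) p = Iio (-b) := by
      rw [neg_chart_source, neg_chart_source, neg_chart_image, hB]
      ext t
      rw [Set.mem_neg, mem_Ioi, mem_Iio, lt_neg]
    obtain ⟨a₂, b₂, h2⟩ := twoEnds_of_core (neg_chart_target he) (neg_chart_target hf) hcov hef hfe hAR hBR
      (strictMonoOn_neg_neg hm)
    exact ⟨_, _, -a, a₂, -b, b₂, neg_chart_target he, neg_chart_target hf, neg_chart_source e, neg_chart_source f, h2⟩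

omit [LocallyConnectedSpace M] [ConnectedSpace M] in
/-- **The hub lemma**: if `p` lies in the source of an arc chart `e` and `Mid` is a preconnected
set disjoint from `e.source` containing its complement, then the compact space minus `p` is
connected: the two rays of `e` at `p` accumulate, by compactness, outside `e.source`, i.e. in
`Mid`. [folklore] -/
theorem isConnected_compl_singleton_of_hub [SecondCountableTopology M] (he : e.target = univ) (hp : p ∈ e.source)
    {Mid : Set M} (hMc : IsPreconnected Mid) (hMe : Disjoint Mid e.source) (hcov : e.sourceᶜ ⊆ Mid) :
    IsConnected ({p}ᶜ : Set M) := by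
  set s := e p with hs
  set Rp := e.symm '' Ioi s with hRp
  set Rm := e.symm '' Iio s with hRm
  have hRpc : IsPreconnected Rp := isPreconnected_Ioi.image _ (arc_continuous_symm he).continuousOn
  have hRmc : IsPreconnected Rm := isPreconnected_Iio.image _ (arc_continuous_symm he).continuousOn
  -- a sequence `e.symm (u n)` with `|u n| → ∞` inside a set `R` has a limit point in `closure R ∖ e.source`
  have hacc : ∀ (u : ℕ → ℝ) (R : Set M), Tendsto (fun n ↦ |u n|) atTop atTop → (∀ n, e.symm (u n) ∈ R) →
      ∃ w, w ∉ e.source ∧ w ∈ closure R := by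
    intro u R hu hmem
    obtain ⟨w, -, φ, hφ, hlim⟩ := isCompact_univ.tendsto_subseq (x := fun n ↦ e.symm (u n)) fun n ↦ mem_univ _
    refine ⟨w, fun hwe ↦ ?_, mem_closure_of_tendsto hlim (Eventually.of_forall fun n ↦ hmem (φ n))⟩
    have hcont : ContinuousAt (fun y ↦ |e y|) w := continuous_abs.continuousAt.comp (e.continuousAt hwe)
    have h1 : Tendsto (fun n ↦ |e (e.symm (u (φ n)))|) atTop (𝓝 |e w|) := hcont.tendsto.comp hlim
    simp only [arc_apply_symm he] at h1
    have h2 : Tendsto (fun n ↦ |u (φ n)|) atTop atTop := hu.comp hφ.tendsto_atTop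
    exact not_tendsto_atTop_of_tendsto_nhds h1 h2
  have htend : ∀ c : ℝ, Tendsto (fun n : ℕ ↦ |c + n|) atTop atTop := fun c ↦ by
    refine tendsto_atTop_atTop.2 fun b ↦ ⟨Nat.ceil (|b| + |c|), fun n hn ↦ ?_⟩
    have hn' : (|b| + |c| : ℝ) ≤ n := (Nat.le_ceil _).trans (Nat.cast_le.2 hn)
    have : b ≤ c + n := by linarith [le_abs_self b, neg_abs_le c]
    exact this.trans (le_abs_self _)
  have htend' : ∀ c : ℝ, Tendsto (fun n : ℕ ↦ |c - n|) atTop atTop := fun c ↦ by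
    have : (fun n : ℕ ↦ |c - n|) = fun n : ℕ ↦ |(-c) + n| := by
      funext n; rw [← abs_neg]; congr 1; ring
    rw [this]; exact htend (-c)
  obtain ⟨wp, hwpe, hwpcl⟩ := hacc (fun n ↦ (s + 1) + n) Rp (htend (s + 1))
    (fun n ↦ mem_image_of_mem _ (show s < s + 1 + n by linarith [n.cast_nonneg (α := ℝ)]))
  obtain ⟨wm, hwme, hwmcl⟩ := hacc (fun n ↦ (s - 1) - n) Rm (htend' (s - 1))
    (fun n ↦ mem_image_of_mem _ (show s - 1 - n < s by linarith [n.cast_nonneg (α := ℝ)]))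
  have hwpM : wp ∈ Mid := hcov hwpe
  have hwmM : wm ∈ Mid := hcov hwme
  -- the rays with their limit points added are preconnected
  have hTp : IsPreconnected (insert wp Rp) :=
    hRpc.subset_closure (subset_insert _ _) (insert_subset hwpcl subset_closure)
  have hTm : IsPreconnected (insert wm Rm) :=
    hRmc.subset_closure (subset_insert _ _) (insert_subset hwmcl subset_closure)
  -- the decomposition of the complement of `p`
  have hdecomp : ({p}ᶜ : Set M) = (insert wp Rp ∪ Mid) ∪ insert wm Rm := by
    apply Subset.antisymm
    · intro q hq
      rw [mem_compl_iff, mem_singleton_iff] at hq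
      by_cases hqe : q ∈ e.source
      · have hne : e q ≠ s := fun h ↦ hq (e.injOn hqe hp (h.trans hs))
        rcases lt_or_gt_of_ne hne with h | h
        · exact Or.inr (Or.inr ⟨e q, h, e.left_inv hqe⟩)
        · exact Or.inl (Or.inl (Or.inr ⟨e q, h, e.left_inv hqe⟩))
      · exact Or.inl (Or.inr (hcov hqe))
    · have hMid : Mid ⊆ ({p}ᶜ : Set M) := fun q hq hqp ↦ by
        rw [mem_singleton_iff] at hqp
        exact Set.disjoint_left.1 hMe hq (hqp ▸ hp)
      have hray : ∀ t : ℝ, t ≠ s → e.symm t ∈ ({p}ᶜ : Set M) := fun t ht hmem ↦ by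
        rw [mem_singleton_iff] at hmem
        have : e (e.symm t) = e p := by rw [hmem]
        rw [arc_apply_symm he] at this
        exact ht this
      rintro q ((hq | hq) | hq)
      · rcases hq with rfl | ⟨t, ht, rfl⟩
        · exact hMid hwpM
        · exact hray t (ne_of_gt ht)
      · exact hMid hq
      · rcases hq with rfl | ⟨t, ht, rfl⟩
        · exact hMid hwmM
        · exact hray t (ne_of_lt ht)
  rw [hdecomp]
  refine ⟨⟨wp, Or.inl (Or.inl (mem_insert _ _))⟩, ?_⟩
  have h1 : IsPreconnected (insert wp Rp ∪ Mid) :=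
    hTp.union wp (mem_insert _ _) hwpM hMc
  exact h1.union wm (Or.inr hwmM) (mem_insert _ _) hTm

/-- **A compact space covered by two compatible arc charts, minus any point, is connected.**
[folklore] -/
theorem isConnected_compl_singleton_of_pair [SecondCountableTopology M] (he : e.target = univ) (hf : f.target = univ)
    (hcov : e.source ∪ f.source = univ)
    (hcompat : ∀ q ∈ e.source ∩ f.source, ∀ᶠ r in 𝓝 q, (e r < e q ↔ f r < f q) ∧ (e q < e r ↔ f q < f r))
    (p : M) : IsConnected ({p}ᶜ : Set M) := by
  obtain ⟨e', f', a₁, a₂, b₁, b₂, he', hf', hse, hsf, ha, h₁, h₂, hov, -, -⟩ := exists_twoEnds_of_pair he hf hcov hcompat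
  rw [← hse, ← hsf] at hcov
  -- the middle pieces
  have hcovM : ∀ q, q ∈ e'.source ∨ q ∈ f'.source := fun q ↦ by
    have : q ∈ e'.source ∪ f'.source := by rw [hcov]; exact mem_univ _
    exact this
  by_cases hpe : p ∈ e'.source
  · -- hub `e'`, middle of `f'`
    refine isConnected_compl_singleton_of_hub he' hpe (Mid := f'.symm '' Icc b₁ b₂)
      (isPreconnected_Icc.image _ (arc_continuous_symm hf').continuousOn) ?_ ?_
    · rw [Set.disjoint_left]
      rintro _ ⟨t, ht, rfl⟩ hte
      have hov' : f'.symm t ∈ e'.source ∩ f'.source := ⟨hte, arc_symm_mem hf' t⟩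
      rw [hov, h₁, h₂] at hov'
      rcases hov' with ⟨t', ht', hEq⟩ | ⟨t', ht', hEq⟩
      · have := congrArg f' hEq
        rw [arc_apply_symm hf', arc_apply_symm hf'] at this
        rw [← this] at ht
        exact absurd ht.1 (not_le.2 ht')
      · have := congrArg f' hEq
        rw [arc_apply_symm hf', arc_apply_symm hf'] at this
        rw [← this] at ht
        exact absurd ht.2 (not_le.2 ht')
    · intro q hq
      rcases hcovM q with h | h
      · exact absurd h hq
      · refine ⟨f' q, ?_, f'.left_inv h⟩
        -- `q ∈ f'.source ∖ e'.source` has coordinate in `[b₁, b₂]`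
        by_contra hnot
        rw [mem_Icc, not_and_or, not_le, not_le] at hnot
        have hq' : q ∈ e'.source ∩ f'.source := by
          rw [hov, h₁, h₂]
          rcases hnot with hlt | hlt
          · exact Or.inl ⟨f' q, hlt, f'.left_inv h⟩
          · exact Or.inr ⟨f' q, hlt, f'.left_inv h⟩
        exact hq hq'.1
  · have hpf : p ∈ f'.source := (hcovM p).resolve_left hpe
    refine isConnected_compl_singleton_of_hub hf' hpf (Mid := e'.symm '' Icc a₂ a₁)
      (isPreconnected_Icc.image _ (arc_continuous_symm he').continuousOn) ?_ ?_
    · rw [Set.disjoint_left]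
      rintro _ ⟨t, ht, rfl⟩ htf
      have hov' : e'.symm t ∈ e'.source ∩ f'.source := ⟨arc_symm_mem he' t, htf⟩
      rw [hov] at hov'
      rcases hov' with ⟨t', ht', hEq⟩ | ⟨t', ht', hEq⟩
      · have := congrArg e' hEq
        rw [arc_apply_symm he', arc_apply_symm he'] at this
        rw [← this] at ht
        exact absurd ht.2 (not_le.2 ht')
      · have := congrArg e' hEq
        rw [arc_apply_symm he', arc_apply_symm he'] at this
        rw [← this] at ht
        exact absurd ht.1 (not_le.2 ht')
    · intro q hq
      rcases hcovM q with h | h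
      · refine ⟨e' q, ?_, e'.left_inv h⟩
        by_contra hnot
        rw [mem_Icc, not_and_or, not_le, not_le] at hnot
        have hq' : q ∈ e'.source ∩ f'.source := by
          rw [hov]
          rcases hnot with hlt | hlt
          · exact Or.inr ⟨e' q, hlt, e'.left_inv h⟩
          · exact Or.inl ⟨e' q, hlt, e'.left_inv h⟩
        exact hq hq'.2
      · exact absurd h hq

end Generic

/-! ## Compact leaves -/

section Leaf

variable {X : Type*} [TopologicalSpace X] [T2Space X] [SecondCountableTopology X] {F : Foliation ℝ X} {x : X}

/-- **A compact leaf of a bi-oriented foliation, minus any point, is connected** (in the leaf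
topology). [folklore] -/
theorem isConnected_compl_singleton [CompactSpace (F.Leaf x)] (hbi : IsBiOriented F) (p : F.Leaf x) :
    IsConnected ({p}ᶜ : Set (F.Leaf x)) := by
  obtain ⟨g₁, g₂, hg₁, hg₂, hcov, ha₁, ha₂⟩ := exists_two_agreeing_arcCharts (x := x) hbi
  exact isConnected_compl_singleton_of_pair hg₁ hg₂ hcov (fun q hq ↦ eventually_lt_iff_of_agrees ha₁ ha₂ hq) p

/-- A compact leaf (as a subset of `X`) is a compact space in its leaf topology. [folklore] -/
theorem compactSpace_leaf_of_isCompact (hC : IsCompact (F.leaf x)) : CompactSpace (F.Leaf x) := by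
  have : CompactSpace (F.leaf x) := isCompact_iff_compactSpace.1 hC
  exact (F.leafHomeomorphOfIsCompact hC).symm.compactSpace

/-- **A compact leaf minus a point is connected in the ambient space.** [folklore] -/
theorem isConnected_leaf_diff_singleton (hbi : IsBiOriented F) (hC : IsCompact (F.leaf x)) {z : X} (hz : z ∈ F.leaf x) :
    IsConnected (F.leaf x \ {z}) := by
  have := compactSpace_leaf_of_isCompact hC
  set p : F.Leaf x := Leaf.mk z hz with hp
  have hconn := isConnected_compl_singleton hbi p
  -- image under the continuous injective map `Leaf x → X`
  have himg : (fun q : F.Leaf x ↦ ofLeafSpace (q : F.LeafSpace)) '' ({p}ᶜ : Set (F.Leaf x)) = F.leaf x \ {z} := by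
    apply Subset.antisymm
    · rintro _ ⟨q, hq, rfl⟩
      refine ⟨q.2, fun h ↦ hq ?_⟩
      rw [mem_singleton_iff] at h ⊢
      exact Leaf.injective_coe F x (h.trans rfl)
    · rintro y ⟨hy, hyz⟩
      refine ⟨Leaf.mk y hy, fun h ↦ hyz ?_, rfl⟩
      rw [mem_singleton_iff] at h ⊢
      have := congrArg (fun q : F.Leaf x ↦ ofLeafSpace (q : F.LeafSpace)) h
      exact this
  rw [← himg]
  exact hconn.image _ (Leaf.continuous_coe F x).continuousOn

end Leaf

end Literature.Topology.PlanarFoliations
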